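import Literature.AlgebraicGeometry.HodgeTheory.HardLefschetzHodgeRiemannHolds
import Literature.AlgebraicGeometry.HodgeTheory.ComplexOrientationFamily
import Literature.AlgebraicGeometry.HodgeTheory.TopDegreeClasses
import HarnessLib

/-!
# A rational `(1,1)`-class dies as soon as it pairs to zero with every rational `(m-1,m-1)`-class

Family `hodge`, layer `Literature/AlgebraicGeometry/HodgeTheory`. The first step of the proof of
Voisin's Lemma 9.18 ("if `Z` is rationally equivalent to `0`, then `[Z] = 0`") on the tree's real
carriers through the HODGE INDEX THEOREM rather than through the Thom class of a divisor: on a smooth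
projective complex `m`-fold `T` the cup product is a perfect pairing between the rational
`(1,1)`-classes and the rational `(m-1,m-1)`-classes (P. Brosnan, H. Fang, Z. Nie, G. Pearlstein,
*Singularities of admissible normal functions*, Invent. Math. 177 (2009), §6 (6.1): "By Poincaré
duality and the Hodge–Riemann bilinear relations, the cup product […] restricts to give a perfect
pairing `Hdg^k Y ⊗ Hdg^{dim Y - k} Y → ℚ`"; C. Voisin, *Hodge Theory and Complex Algebraic Geometry I*
(2002), Thm. 6.32 and §7.1.2 — the tree's `hodgeClasses_cupPairing_nondegenerate`, a THEOREM of the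
tree through `hardLefschetz_hodgeRiemann_holds`), so a rational `(1,1)`-class `x ∈ H²(T(ℂ); ℂ)` — e.g.
the cycle class of a principal divisor — vanishes as soon as `⟨x ∪ a, [T(ℂ)]⟩ = 0` for every rational
`(m-1,m-1)`-class `a`:

* `eq_zero_of_kroneckerPairing_fundamentalClass_eq_zero` — **a top-degree class `z ∈ H^{2m}(T(ℂ); ℂ)`
  with `⟨z, [T(ℂ)]⟩ = 0` is zero** (`[T(ℂ)]` the fundamental class of the complex orientation family:
  Poincaré duality `z ↦ z ⌢ [T(ℂ)]` is one-to-one and `ε : H₀(T(ℂ); ℂ) → ℂ` is an isomorphism, `T(ℂ)`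
  being path connected);
* `eq_zero_of_forall_cupProduct_hodgeClass_eq_zero` — the perfect pairing, contrapositive form;
* `eq_zero_of_forall_kroneckerPairing_cupProduct_hodgeClass_eq_zero` — **a rational `(1,1)`-class
  `x` with `⟨x ∪ a, [T(ℂ)]⟩ = 0` for all rational `(m-1,m-1)`-classes `a` is `0`.**

Everything is proved; no definitions, no named facts.

## References

* [BrosnanFangNiePearlstein2009] P. Brosnan, H. Fang, Z. Nie, G. Pearlstein, Singularities of
  admissible normal functions, Invent. Math. 177 (2009), §6 (6.1).
* [VoisinHodgeI2002] C. Voisin, Hodge Theory and Complex Algebraic Geometry I, CUP 2002, Thm. 6.32,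
  §7.1.2.
* [VoisinHodgeII2003] C. Voisin, Hodge Theory and Complex Algebraic Geometry II, CUP 2003, Lemma 9.18.
* [HatcherAT2002] A. Hatcher, Algebraic Topology, CUP 2002, Prop. 2.7, §3.3 Thm. 3.30.
-/

noncomputable section

open CategoryTheory AlgebraicGeometry
open Literature.AlgebraicTopology.SingularHomology

namespace Literature.AlgebraicGeometry.HodgeTheory

section HodgeTheory

variable {m : ℕ} {T : Motives.SchemeOver ℂ}

/-- **A top-degree class pairing to zero with the fundamental class vanishes**: for `T` smooth
projective of dimension `m` and `z ∈ H^{2m}(T(ℂ); ℂ)`, `⟨z, [T(ℂ)]⟩ = 0` forces `z = 0`, where `[T(ℂ)]`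
is the fundamental class of the complex orientation family (`⟨z, [T(ℂ)]⟩ = ε (z ⌢ [T(ℂ)])`, Poincaré
duality `H^{2m} → H₀` is one-to-one and `ε` is an isomorphism on the path-connected `T(ℂ)`).
[cite: HatcherAT2002, Prop. 2.7 and §3.3 Thm. 3.30] -/
theorem eq_zero_of_kroneckerPairing_fundamentalClass_eq_zero (hT : Motives.IsSmoothProjective m T)
    {z : complexBetti T (2 * m)}
    (hz : kroneckerPairing ℂ ℂ (Motives.ComplexPoints T) (2 * m) z
      (complexOrientationFamily hT).fundamentalClass = 0) : z = 0 := by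
  letI := hT.chartedSpace
  haveI := connectedSpace_complexPoints hT
  haveI : LocallyPathConnectedSpace (Motives.ComplexPoints T) :=
    ChartedSpace.locallyPathConnectedSpace (EuclideanSpace ℝ (Fin (2 * m))) (Motives.ComplexPoints T)
  haveI : PathConnectedSpace (Motives.ComplexPoints T) := pathConnectedSpace_iff_connectedSpace.mpr ‹_›
  haveI : IsIso (singularHomology.ε ℂ ℂ (Motives.ComplexPoints T)) :=
    singularHomology.isIso_ε_of_pathConnectedSpace ℂ ℂ
  have hPD := hasPoincareDuality_complexOrientationFamily hT (Nat.add_zero (2 * m))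
  -- `z ⌢ [T(ℂ)] = 0` in `H₀`, since `ε` of it vanishes and `ε` is one-to-one
  have hcap : capProduct (Nat.add_zero (2 * m)) z (complexOrientationFamily hT).fundamentalClass = 0 := by
    have hinj : Function.Injective (singularHomology.ε ℂ ℂ (Motives.ComplexPoints T)) :=
      (ConcreteCategory.bijective_of_isIso (singularHomology.ε ℂ ℂ (Motives.ComplexPoints T))).1
    apply hinj
    rw [map_zero]
    apply ULift.ext
    rw [kroneckerPairing_apply] at hz
    exact hz
  apply hPD.1
  rw [poincareDualityMap_apply, poincareDualityMap_apply, map_zero, LinearMap.zero_apply]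
  exact hcap

/-- **The cup product is a perfect pairing between rational `(1,1)`- and `(m-1,m-1)`-classes**,
contrapositive form: on a smooth projective `m`-fold `T`, `m ≥ 1`, a rational class
`x ∈ H²(T(ℂ); ℂ)` of Hodge type `(1,1)` with `x ∪ a = 0` for every rational `(m-1,m-1)`-class
`a ∈ H^{2(m-1)}(T(ℂ); ℂ)` is `0` (the tree's `hodgeClasses_cupPairing_nondegenerate`, a theorem through
`hardLefschetz_hodgeRiemann_holds`). [cite: BrosnanFangNiePearlstein2009, §6 (6.1)]
[cite: VoisinHodgeI2002, Thm. 6.32 and §7.1.2] -/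
theorem eq_zero_of_forall_cupProduct_hodgeClass_eq_zero (hT : Motives.IsSmoothProjective m T)
    (hm : 1 ≤ m) {x : complexBetti T (2 * 1)} (hx : IsRationalClass x)
    (hx' : IsOfHodgeType m T (2 * 1) 1 1 x)
    (h : ∀ a : complexBetti T (2 * (m - 1)), IsRationalClass a →
      IsOfHodgeType m T (2 * (m - 1)) (m - 1) (m - 1) a →
        cupProduct (show 2 * 1 + 2 * (m - 1) = 2 * m by omega) x a = 0) : x = 0 := by
  by_contra hx0
  obtain ⟨a, ha, ha', hne⟩ :=
    hardLefschetz_hodgeRiemann.hodgeClasses_cupPairing_nondegenerate hardLefschetz_hodgeRiemann_holds hT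
      (k := 1) (l := m - 1) (2 * m) (by omega) (show 2 * 1 + 2 * (m - 1) = 2 * m by omega) x hx hx' hx0
  exact hne (h a ha ha')

/-- **A rational `(1,1)`-class pairing to zero with every rational `(m-1,m-1)`-class vanishes**: on a
smooth projective `m`-fold `T`, `m ≥ 1`, if `x ∈ H²(T(ℂ); ℂ)` is rational of Hodge type `(1,1)` and
`⟨x ∪ a, [T(ℂ)]⟩ = 0` for every rational `(m-1,m-1)`-class `a`, then `x = 0` — the form in which the
perfect pairing is used on the cycle class of a principal divisor (Voisin II, Lemma 9.18, through the
Hodge index theorem). [cite: BrosnanFangNiePearlstein2009, §6 (6.1)] [cite: VoisinHodgeII2003, Lemma 9.18] -/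
theorem eq_zero_of_forall_kroneckerPairing_cupProduct_hodgeClass_eq_zero
    (hT : Motives.IsSmoothProjective m T) (hm : 1 ≤ m) {x : complexBetti T (2 * 1)}
    (hx : IsRationalClass x) (hx' : IsOfHodgeType m T (2 * 1) 1 1 x)
    (h : ∀ a : complexBetti T (2 * (m - 1)), IsRationalClass a →
      IsOfHodgeType m T (2 * (m - 1)) (m - 1) (m - 1) a →
        kroneckerPairing ℂ ℂ (Motives.ComplexPoints T) (2 * m)
          (cupProduct (show 2 * 1 + 2 * (m - 1) = 2 * m by omega) x a)
          (complexOrientationFamily hT).fundamentalClass = 0) : x = 0 :=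
  eq_zero_of_forall_cupProduct_hodgeClass_eq_zero hT hm hx hx' fun a ha ha' ↦
    eq_zero_of_kroneckerPairing_fundamentalClass_eq_zero hT (h a ha ha')

end HodgeTheory

end Literature.AlgebraicGeometry.HodgeTheory

end
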